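import Literature.NumberTheory.EllipticCurves.ShimuraSubgroupEisensteinProofs
import Literature.NumberTheory.EllipticCurves.Gamma1CuspEquivalence
import HarnessLib

/-!
# The cuspidal packet is Eisenstein at the primes `ℓ ≡ 1 (mod gcd(den r, N))`:
# `(1 + ℓ − a_ℓ)·({∞, r}_f − {∞, 0}_f) ∈ Λ₁(f)` (THM 92.A of cell bsd-f2-manin, es g63)

[Proofs] Theorems only (no definition, no named fact, no sorry).  Namespace
`Literature.NumberTheory.EllipticCurves.ModularForms`, companion of `ShimuraSubgroupEisensteinProofs.lean`
(`(a_ℓ − ℓ − 1)Λ₀(f) ⊆ Λ₁(f)`, Ribet: the Shimura subgroup is Eisenstein), which is the case `gcd(den r, N) = 1`.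

THE STATEMENT (E-es-363e `CuspClassHeckeAnnihilationEigen` of MEMO-es §92, typed verbatim in
`pub/bsd-f2-manin/es/g63/Sketch-es-g63.lean`; proved here as `cuspClassHeckeAnnihilationEigen`): for `f ∈ S₂(Γ₀(N))`
with `T_ℓ f = a f`, `ℓ ∤ N` prime, `r ∈ ℚ` and `ℓ ≡ 1 (mod gcd(den r, N))`:
`(1 + ℓ − a)·({∞, r}_f − {∞, 0}_f) ∈ Λ₁(f)` (`Λ₁(f) = periodLatticeGamma1 f`, the `Γ₁(N)`-period lattice).
GALOIS READING (not used): in the `Γ₁(N)`-optimal quotient the cuspidal divisor `(r) − (0)` is a torsion point rational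
over `ℚ(μ_δ)`, `δ = gcd(den r, N)`, and Eichler–Shimura `T_ℓ = Frob + ℓ·Frob⁻¹·⟨ℓ⟩` kills it by `1 + ℓ − a_ℓ` at the primes
`ℓ ≡ 1 (mod δ)` (Stevens 1982, Thm. 1.3.1–1.3.2).  THE PROOF HERE is elementary (Manin symbols, as in the companion file):
`a·X(x) = Σ_{j<ℓ} X((x+j)/ℓ) + X(ℓx)` (`modularSymbol_heckeT_eq_sum`), `X := {∞, ·}_f` is a CLASS FUNCTION modulo `Λ₁(f)`
on the `Γ₁(N)`-orbits of `ℙ¹(ℚ)` (`modularSymbol_sub_mem_periodLatticeGamma1_of_mem_Gamma1`), the orbits are classified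
by Diamond–Shurman Prop. 3.8.3 (`exists_mem_Gamma1_vec_eq` of `Gamma1CuspEquivalence.lean`, constructive, from
Lemma 3.8.2 `exists_mem_Gamma_vec_eq`), and for `x = b/M` with `ℓ ≡ 1 (mod gcd(M, N))` every Hecke cusp is congruent to `X(x)`,
`X(x) + t` or `X(x) − t` with `t = {∞, κ∞}_f` for any `κ ∈ Γ₀(N)` of lower-right entry `≡ ℓ`; the count gives
`a·X(x) ≡ (ℓ + 1)·X(x) + (ℓ − 1)·t` for EVERY such `x` (`modularSymbol_hecke_class`), and the `t`'s cancel in `X(r) − X(0)`.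

## References
* [DiamondShurman2005] F. Diamond, J. Shurman, *A first course in modular forms*, Lemma 3.8.2, Prop. 3.8.3 (PDF pp. 119–120),
  Prop. 5.2.1.
* [Stevens1982] G. Stevens, *Arithmetic on modular curves*, Thm. 1.3.1–1.3.2.
* [CremonaAlgorithms1997] J. E. Cremona, *Algorithms for modular elliptic curves*, §2.4 (2.4.1)–(2.4.2).
* [Manin1972] Ju. I. Manin, *Parabolic points and zeta functions of modular curves*, Prop. 1.4, Thm. 1.6.
-/

noncomputable section

open scoped MatrixGroups ModularForm

open CongruenceSubgroup

namespace Literature.NumberTheory.EllipticCurves.ModularForms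

/-! ### §1 `Γ₁(N)`-equivalence of cusps (Diamond–Shurman, Prop. 3.8.3, the `+` sign) = `Gamma1CuspEquivalence.lean`
(`exists_mem_Gamma1_vec_eq`, `exists_mem_Gamma1_moebius_eq`, `gamma1CuspMove`), imported. -/

/-! ### §2 `{∞, ·}_f` modulo `Λ₁(f)` is a class function on the `Γ₁(N)`-orbits of the cusps -/

variable {N : ℕ} [NeZero N] (f : CuspForm (Gamma0 N) 2)

/-- **`{∞, γr}_f − {∞, r}_f ∈ Λ₁(f)` for `γ ∈ Γ₁(N)`** (`γ r ≠ ∞`): Manin's relation `{∞, γr} = {∞, γ∞} + {∞, r}`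
(`modularSymbol_gamma0_smul_holds`) and `{∞, γ∞}_f ∈ Λ₁(f)` (`d_γ ≡ 1`).  (Kernel-checked first by es g63 as lemma K-b.)
[cite: Manin1972, Prop. 1.4, Thm. 1.6] -/
theorem modularSymbol_sub_mem_periodLatticeGamma1_of_mem_Gamma1 (γ : SL(2, ℤ)) (hγ : γ ∈ Gamma1 N) (r : ℚ)
    (hr : ((γ 1 0 : ℚ)) * r + ((γ 1 1 : ℚ)) ≠ 0) :
    modularSymbol f ((((γ 0 0 : ℚ)) * r + ((γ 0 1 : ℚ))) / (((γ 1 0 : ℚ)) * r + ((γ 1 1 : ℚ)))) -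
      modularSymbol f r ∈ periodLatticeGamma1 f := by
  have hγ0 : γ ∈ Gamma0 N := Gamma1_in_Gamma0 N hγ
  have h := modularSymbol_gamma0_smul_holds f ⟨γ, hγ0⟩ r hr
  have h' : modularSymbol f ((((γ 0 0 : ℚ)) * r + ((γ 0 1 : ℚ))) / (((γ 1 0 : ℚ)) * r + ((γ 1 1 : ℚ)))) -
      modularSymbol f r = cuspSymbol f ⟨γ, hγ0⟩ := by
    rw [h]; ring
  rw [h']
  exact cuspSymbol_mem_periodLatticeGamma1_of_apply_eq_one f ⟨γ, hγ0⟩ ((Gamma1_mem N γ).mp hγ).2.1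

/-- **Congruent cusps have congruent symbols modulo `Λ₁(f)`** (Diamond–Shurman Prop. 3.8.3 + Manin): for primitive
`(a, c)`, `(a', c')` with `c, c' ≠ 0`, `c' ≡ c (mod N)`, `a' ≡ a (mod gcd(c, N))`:
`{∞, a'/c'}_f − {∞, a/c}_f ∈ Λ₁(f)`. [cite: DiamondShurman2005, Prop. 3.8.3 (PDF p. 120)] [cite: Manin1972, Thm. 1.6] -/
theorem modularSymbol_sub_mem_periodLatticeGamma1_of_congr {a c a' c' : ℤ} (hac : IsCoprime a c)
    (hac' : IsCoprime a' c') (hc0 : c ≠ 0) (hc0' : c' ≠ 0) (hc : (c' : ZMod N) = c)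
    (ha : (a' : ZMod (Int.gcd c N)) = a) :
    modularSymbol f ((a' : ℚ) / c') - modularSymbol f ((a : ℚ) / c) ∈ periodLatticeGamma1 f := by
  obtain ⟨γ, hγ, h0, h1⟩ := exists_mem_Gamma1_vec_eq hac hac' hc ha
  have hcQ : (c : ℚ) ≠ 0 := by exact_mod_cast hc0
  have hcQ' : (c' : ℚ) ≠ 0 := by exact_mod_cast hc0'
  have h0Q : (γ 0 0 : ℚ) * a + (γ 0 1 : ℚ) * c = a' := by exact_mod_cast h0
  have h1Q : (γ 1 0 : ℚ) * a + (γ 1 1 : ℚ) * c = c' := by exact_mod_cast h1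
  have hden : (γ 1 0 : ℚ) * ((a : ℚ) / c) + (γ 1 1 : ℚ) = (c' : ℚ) / c := by
    field_simp; linear_combination h1Q
  have hnum : (γ 0 0 : ℚ) * ((a : ℚ) / c) + (γ 0 1 : ℚ) = (a' : ℚ) / c := by
    field_simp; linear_combination h0Q
  have hr : (γ 1 0 : ℚ) * ((a : ℚ) / c) + (γ 1 1 : ℚ) ≠ 0 := by rw [hden]; exact div_ne_zero hcQ' hcQ
  have h := modularSymbol_sub_mem_periodLatticeGamma1_of_mem_Gamma1 f γ hγ ((a : ℚ) / c) hr
  have heq : ((γ 0 0 : ℚ) * ((a : ℚ) / c) + (γ 0 1 : ℚ)) / ((γ 1 0 : ℚ) * ((a : ℚ) / c) + (γ 1 1 : ℚ)) =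
      (a' : ℚ) / c' := by
    rw [hden, hnum]; field_simp
  rwa [heq] at h

/-! ### §3 The diamond step: a cusp of class `⟨ℓ⟩·[a/c]` has symbol `{∞, κ∞}_f + {∞, a/c}_f` modulo `Λ₁(f)` -/

omit [NeZero N] in
/-- Transfer of an integer congruence along a divisibility of moduli. [folklore] -/
private theorem intCast_zmod_eq_of_dvd {m n : ℕ} (h : m ∣ n) {x y : ℤ} (hxy : (x : ZMod n) = y) : (x : ZMod m) = y := by
  have := congrArg (ZMod.castHom h (ZMod m)) hxy
  simpa using this

omit [NeZero N] in
/-- Transfer of a natural-number congruence along a divisibility of moduli. [folklore] -/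
private theorem natCast_zmod_eq_of_dvd {m n : ℕ} (h : m ∣ n) {x y : ℕ} (hxy : (x : ZMod n) = y) : (x : ZMod m) = y := by
  have := congrArg (ZMod.castHom h (ZMod m)) hxy
  simpa using this

/-- **Pole avoidance**: for `κ ∈ Γ₀(N)` and `y ∈ ℚ` there is `κ' ∈ Γ₀(N)` (namely `κ` or `κT`) with the same period
`{∞, κ'∞}_f = {∞, κ∞}_f`, the same lower-right entry modulo `N`, and `κ' y ≠ ∞`. [cite: Manin1972, Prop. 1.4] -/
theorem exists_gamma0_cuspSymbol_eq_apply_ne_zero (κ : Gamma0 N) (y : ℚ) :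
    ∃ κ' : Gamma0 N, cuspSymbol f κ' = cuspSymbol f κ ∧
      ((((κ' : SL(2, ℤ)) 1 1 : ℤ) : ZMod N) = (((κ : SL(2, ℤ)) 1 1 : ℤ) : ZMod N)) ∧
      ((κ' : SL(2, ℤ)) 1 0 : ℚ) * y + ((κ' : SL(2, ℤ)) 1 1 : ℚ) ≠ 0 := by
  by_cases h : ((κ : SL(2, ℤ)) 1 0 : ℚ) * y + ((κ : SL(2, ℤ)) 1 1 : ℚ) = 0
  · have hT0 : ModularGroup.T ∈ Gamma0 N := by
      rw [Gamma0_mem, ModularGroup.coe_T]; simp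
    have hdet : ((κ : SL(2, ℤ)) 0 0 : ℤ) * (κ : SL(2, ℤ)) 1 1 - (κ : SL(2, ℤ)) 0 1 * (κ : SL(2, ℤ)) 1 0 = 1 := by
      have h := Matrix.SpecialLinearGroup.det_coe (κ : SL(2, ℤ)); rw [Matrix.det_fin_two] at h; exact h
    have hc0 : ((κ : SL(2, ℤ)) 1 0 : ℚ) ≠ 0 := by
      intro hc
      have hcZ : ((κ : SL(2, ℤ)) 1 0 : ℤ) = 0 := by exact_mod_cast hc
      rw [hc, zero_mul, zero_add] at h
      have hdZ : ((κ : SL(2, ℤ)) 1 1 : ℤ) = 0 := by exact_mod_cast h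
      rw [hcZ, hdZ, mul_zero, mul_zero, sub_zero] at hdet
      exact zero_ne_one hdet
    have hNc : (N : ℤ) ∣ (κ : SL(2, ℤ)) 1 0 := dvd_entry_of_mem_Gamma0 N κ.2
    have e10 : (((κ * ⟨ModularGroup.T, hT0⟩ : Gamma0 N) : SL(2, ℤ)) 1 0 : ℤ) = (κ : SL(2, ℤ)) 1 0 := by
      show (((κ : SL(2, ℤ)) * ModularGroup.T : SL(2, ℤ)) 1 0 : ℤ) = _
      rw [Matrix.SpecialLinearGroup.coe_mul, ModularGroup.coe_T]
      simp [Matrix.mul_apply, Fin.sum_univ_two]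
    have e11 : (((κ * ⟨ModularGroup.T, hT0⟩ : Gamma0 N) : SL(2, ℤ)) 1 1 : ℤ) =
        (κ : SL(2, ℤ)) 1 0 + (κ : SL(2, ℤ)) 1 1 := by
      show (((κ : SL(2, ℤ)) * ModularGroup.T : SL(2, ℤ)) 1 1 : ℤ) = _
      rw [Matrix.SpecialLinearGroup.coe_mul, ModularGroup.coe_T]
      simp [Matrix.mul_apply, Fin.sum_univ_two]
    refine ⟨κ * ⟨ModularGroup.T, hT0⟩, ?_, ?_, ?_⟩
    · rw [cuspSymbol_mul_holds f κ ⟨ModularGroup.T, hT0⟩]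
      have hT : cuspSymbol f (⟨ModularGroup.T, hT0⟩ : Gamma0 N) = 0 := by
        unfold cuspSymbol
        rw [if_pos]
        show (ModularGroup.T : SL(2, ℤ)) 1 0 = 0
        rw [ModularGroup.coe_T]; simp
      rw [hT, add_zero]
    · rw [e11, Int.cast_add, (ZMod.intCast_zmod_eq_zero_iff_dvd _ N).mpr hNc, zero_add]
    · rw [e11, e10]
      push_cast
      have : ((κ : SL(2, ℤ)) 1 0 : ℚ) * y + (((κ : SL(2, ℤ)) 1 0 : ℚ) + ((κ : SL(2, ℤ)) 1 1 : ℚ)) =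
          ((κ : SL(2, ℤ)) 1 0 : ℚ) := by linear_combination h
      rw [this]; exact hc0
  · exact ⟨κ, rfl, rfl, h⟩

/-- **The diamond step.**  Let `κ ∈ Γ₀(N)` have lower-right entry `≡ ℓ (mod N)` and no pole at `a/c` (`(a, c)` primitive,
`c ≠ 0`), and let `(a', c')` be primitive with `c' ≠ 0`, `c' ≡ ℓc (mod N)`, `a' ≡ a (mod gcd(c, N))`; assume
`ℓ ≡ 1 (mod gcd(c, N))`.  Then `{∞, a'/c'}_f ≡ {∞, κ∞}_f + {∞, a/c}_f (mod Λ₁(f))`: indeed `κ(a/c) = p/q` with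
`q ≡ ℓc ≡ c'` and `p ≡ κ₀₀a ≡ a ≡ a' (mod gcd(c, N) ⊇ gcd(q, N))` (`κ₀₀ ≡ ℓ⁻¹ ≡ 1`), so Prop. 3.8.3 applies to
`(p, q)` and `(a', c')`, while `{∞, κ(a/c)} = {∞, κ∞} + {∞, a/c}` (Manin).
[cite: DiamondShurman2005, Prop. 3.8.3 (PDF p. 120)] [cite: Manin1972, Prop. 1.4, Thm. 1.6] -/
theorem modularSymbol_sub_sub_cuspSymbol_mem_periodLatticeGamma1 (κ : Gamma0 N) {ℓ : ℕ}
    (hκ : (((κ : SL(2, ℤ)) 1 1 : ℤ) : ZMod N) = (ℓ : ZMod N)) {a c a' c' : ℤ} (hac : IsCoprime a c)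
    (hac' : IsCoprime a' c') (hc0 : c ≠ 0) (hc0' : c' ≠ 0)
    (hpole : ((κ : SL(2, ℤ)) 1 0 : ℚ) * ((a : ℚ) / c) + ((κ : SL(2, ℤ)) 1 1 : ℚ) ≠ 0)
    (hc' : (c' : ZMod N) = (ℓ : ZMod N) * c) (ha' : (a' : ZMod (Int.gcd c N)) = a)
    (hℓ1 : (ℓ : ZMod (Int.gcd c N)) = 1) :
    modularSymbol f ((a' : ℚ) / c') - modularSymbol f ((a : ℚ) / c) - cuspSymbol f κ ∈ periodLatticeGamma1 f := by
  set p : ℤ := (κ : SL(2, ℤ)) 0 0 * a + (κ : SL(2, ℤ)) 0 1 * c with hp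
  set q : ℤ := (κ : SL(2, ℤ)) 1 0 * a + (κ : SL(2, ℤ)) 1 1 * c with hq
  have hdet : ((κ : SL(2, ℤ)) 0 0 : ℤ) * (κ : SL(2, ℤ)) 1 1 - (κ : SL(2, ℤ)) 0 1 * (κ : SL(2, ℤ)) 1 0 = 1 := by
    have h := Matrix.SpecialLinearGroup.det_coe (κ : SL(2, ℤ)); rw [Matrix.det_fin_two] at h; exact h
  have hNκ : (N : ℤ) ∣ (κ : SL(2, ℤ)) 1 0 := dvd_entry_of_mem_Gamma0 N κ.2
  have hcQ : (c : ℚ) ≠ 0 := by exact_mod_cast hc0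
  have hqQ : (q : ℚ) = c * (((κ : SL(2, ℤ)) 1 0 : ℚ) * ((a : ℚ) / c) + ((κ : SL(2, ℤ)) 1 1 : ℚ)) := by
    simp only [hq]; push_cast; field_simp
  have hq0 : q ≠ 0 := by
    intro h0
    have : (q : ℚ) = 0 := by exact_mod_cast h0
    rw [hqQ] at this
    rcases mul_eq_zero.mp this with h1 | h1
    · exact hcQ h1
    · exact hpole h1
  have hpq : IsCoprime p q := by
    obtain ⟨u, v, huv⟩ := hac
    refine ⟨u * (κ : SL(2, ℤ)) 1 1 - v * (κ : SL(2, ℤ)) 1 0, -u * (κ : SL(2, ℤ)) 0 1 + v * (κ : SL(2, ℤ)) 0 0, ?_⟩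
    simp only [hp, hq]; linear_combination (u * a + v * c) * hdet + huv
  -- Manin: `{∞, κ(a/c)} = {∞, κ∞} + {∞, a/c}`, and `κ(a/c) = p/q`
  have hσ := modularSymbol_gamma0_smul_holds f κ ((a : ℚ) / c) hpole
  have hfrac : (((κ : SL(2, ℤ)) 0 0 : ℚ) * ((a : ℚ) / c) + ((κ : SL(2, ℤ)) 0 1 : ℚ)) /
      (((κ : SL(2, ℤ)) 1 0 : ℚ) * ((a : ℚ) / c) + ((κ : SL(2, ℤ)) 1 1 : ℚ)) = (p : ℚ) / q := by
    have hpQ : (p : ℚ) = c * (((κ : SL(2, ℤ)) 0 0 : ℚ) * ((a : ℚ) / c) + ((κ : SL(2, ℤ)) 0 1 : ℚ)) := by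
      simp only [hp]; push_cast; field_simp
    rw [hpQ, hqQ, mul_div_mul_left _ _ hcQ]
  rw [hfrac] at hσ
  -- classes: `q ≡ ℓc ≡ c' (mod N)`
  have hcq : (c' : ZMod N) = q := by
    simp only [hq]; push_cast
    rw [(ZMod.intCast_zmod_eq_zero_iff_dvd _ N).mpr hNκ, zero_mul, zero_add, hκ, hc']
  -- moduli: `gcd(q, N) ∣ d := gcd(c, N)` (`c = κ₀₀ q − κ₁₀ p`, `N ∣ κ₁₀`)
  set d : ℕ := Int.gcd c N with hd
  have hd_c : (d : ℤ) ∣ c := Int.gcd_dvd_left c N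
  have hd_N : (d : ℤ) ∣ (N : ℤ) := Int.gcd_dvd_right c N
  have hg_q : ((Int.gcd q N : ℕ) : ℤ) ∣ q := Int.gcd_dvd_left q N
  have hg_N : ((Int.gcd q N : ℕ) : ℤ) ∣ (N : ℤ) := Int.gcd_dvd_right q N
  have hc_eq : c = (κ : SL(2, ℤ)) 0 0 * q - (κ : SL(2, ℤ)) 1 0 * p := by
    simp only [hp, hq]; linear_combination (-c) * hdet
  have hg_c : ((Int.gcd q N : ℕ) : ℤ) ∣ c := by
    rw [hc_eq]; exact dvd_sub (hg_q.mul_left _) ((hg_N.trans hNκ).mul_right _)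
  have hg_dvd : Int.gcd q N ∣ d := by
    have h : ((Int.gcd q N : ℕ) : ℤ) ∣ ((d : ℕ) : ℤ) := Int.dvd_coe_gcd hg_c hg_N
    exact_mod_cast h
  -- congruences modulo `d`
  have hκ10_d : (((κ : SL(2, ℤ)) 1 0 : ℤ) : ZMod d) = 0 := (ZMod.intCast_zmod_eq_zero_iff_dvd _ d).mpr (hd_N.trans hNκ)
  have hc_d : ((c : ℤ) : ZMod d) = 0 := (ZMod.intCast_zmod_eq_zero_iff_dvd _ d).mpr hd_c
  have hκ11_d : (((κ : SL(2, ℤ)) 1 1 : ℤ) : ZMod d) = 1 := by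
    have h := intCast_zmod_eq_of_dvd (Int.natCast_dvd_natCast.mp hd_N) (x := (κ : SL(2, ℤ)) 1 1) (y := (ℓ : ℤ))
      (by push_cast; exact hκ)
    rw [h]; push_cast; exact hℓ1
  have hκ00_d : (((κ : SL(2, ℤ)) 0 0 : ℤ) : ZMod d) = 1 := by
    have h := congrArg (Int.cast : ℤ → ZMod d) hdet
    push_cast at h
    rw [hκ10_d, hκ11_d, mul_zero, sub_zero, mul_one] at h; exact h
  have hp_d : ((p : ℤ) : ZMod d) = a := by
    simp only [hp]; push_cast; rw [hκ00_d, hc_d, one_mul, mul_zero, add_zero]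
  have ha'p : (a' : ZMod (Int.gcd q N)) = p := by
    apply intCast_zmod_eq_of_dvd hg_dvd
    rw [hp_d]; exact ha'
  have hCL := modularSymbol_sub_mem_periodLatticeGamma1_of_congr f hpq hac' hq0 hc0' hcq ha'p
  rw [hσ] at hCL
  convert hCL using 1; ring

/-! ### §4 The unique `j mod ℓ` with `ℓ ∣ b + jM` (`ℓ ∤ M`) -/

omit [NeZero N] f in
/-- For `ℓ` prime and `ℓ ∤ M` there is exactly one `j ∈ [0, ℓ)` with `ℓ ∣ b + jM`: existence and uniqueness in one
statement. [folklore] -/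
private theorem existsUnique_fin_dvd_add_mul {ℓ : ℕ} (hℓ : ℓ.Prime) {b M : ℤ} (hM : ¬ (ℓ : ℤ) ∣ M) :
    ∃ j₀ : Fin ℓ, (ℓ : ℤ) ∣ b + ((j₀ : ℕ) : ℤ) * M ∧
      ∀ j : Fin ℓ, (ℓ : ℤ) ∣ b + ((j : ℕ) : ℤ) * M → j = j₀ := by
  haveI : Fact ℓ.Prime := ⟨hℓ⟩
  have hℓP : Prime (ℓ : ℤ) := Nat.prime_iff_prime_int.mp hℓ
  have hMℓ : ((M : ℤ) : ZMod ℓ) ≠ 0 := by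
    rwa [Ne, ZMod.intCast_zmod_eq_zero_iff_dvd]
  set x : ZMod ℓ := -(b : ZMod ℓ) * ((M : ℤ) : ZMod ℓ)⁻¹ with hx
  refine ⟨⟨x.val, x.val_lt⟩, ?_, fun j hj ↦ ?_⟩
  · rw [← ZMod.intCast_zmod_eq_zero_iff_dvd]
    push_cast
    rw [ZMod.natCast_zmod_val, hx]
    field_simp
    ring
  · have hjx : ((j : ℕ) : ZMod ℓ) = x := by
      have h := (ZMod.intCast_zmod_eq_zero_iff_dvd _ ℓ).mpr hj
      push_cast at h
      rw [hx]
      field_simp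
      linear_combination h
    apply Fin.ext
    have h2 : ((j : ℕ) : ZMod ℓ) = ((x.val : ℕ) : ZMod ℓ) := by rw [hjx, ZMod.natCast_zmod_val]
    rw [ZMod.natCast_eq_natCast_iff, Nat.ModEq, Nat.mod_eq_of_lt j.isLt, Nat.mod_eq_of_lt x.val_lt] at h2
    exact h2

/-! ### §5 `a·X(x) ≡ (ℓ + 1)·X(x) + (ℓ − 1)·{∞, κ∞}_f` for every cusp `x` with `ℓ ≡ 1 (mod gcd(den x, N))` -/

/-- **The Hecke sum at a cusp, modulo `Λ₁(f)`.**  `T_ℓ f = a f`, `ℓ ∤ N` prime, `κ ∈ Γ₀(N)` with lower-right entry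
`≡ ℓ`, `x = b/M ∈ ℚ` with `ℓ ≡ 1 (mod gcd(M, N))`.  Then
`a·{∞, x}_f − (ℓ + 1)·{∞, x}_f − (ℓ − 1)·{∞, κ∞}_f ∈ Λ₁(f)`:
`a·X(x) = Σ_{j<ℓ} X((b + jM)/(ℓM)) + X(ℓb/M)` (`modularSymbol_heckeT_eq_sum`) and, writing `t = {∞, κ∞}_f`, each term is
`≡ X(x) + t` (the `(b + jM, ℓM)` primitive: diamond step), `≡ X(x)` (the one `j₀` with `ℓ ∣ b + j₀M` when `ℓ ∤ M`, and
`ℓb/M` when `ℓ ∤ M`: Prop. 3.8.3 directly, `ℓ ≡ 1`), or `≡ X(x) − t` (`ℓb/M = b/(M/ℓ)` when `ℓ ∣ M`: diamond step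
backwards).  (MEMO-es §92.2, both cases `ℓ ∤ M` / `ℓ ∣ M`.)
[cite: DiamondShurman2005, Prop. 3.8.3 (PDF p. 120), Prop. 5.2.1] [cite: CremonaAlgorithms1997, §2.4 (2.4.1)–(2.4.2)] -/
theorem modularSymbol_hecke_sub_sub_mem_periodLatticeGamma1 {ℓ : ℕ} [NeZero ℓ] (hℓ : ℓ.Prime) (hℓN : ¬ ℓ ∣ N)
    {a : ℂ} (hT : heckeT (Gamma0 N) 2 ℓ f = a • f) (κ : Gamma0 N)
    (hκ : (((κ : SL(2, ℤ)) 1 1 : ℤ) : ZMod N) = (ℓ : ZMod N)) (x : ℚ) (hx : ℓ ≡ 1 [MOD Nat.gcd x.den N]) :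
    a * modularSymbol f x - ((ℓ : ℂ) + 1) * modularSymbol f x - ((ℓ : ℂ) - 1) * cuspSymbol f κ
      ∈ periodLatticeGamma1 f := by
  have hℓ0 : (ℓ : ℤ) ≠ 0 := by exact_mod_cast hℓ.ne_zero
  have hℓQ : (ℓ : ℚ) ≠ 0 := by exact_mod_cast hℓ.ne_zero
  have hℓP : Prime (ℓ : ℤ) := Nat.prime_iff_prime_int.mp hℓ
  -- `x = b/M` in lowest terms
  set b : ℤ := x.num with hb
  set M : ℤ := (x.den : ℤ) with hM
  have hM0 : M ≠ 0 := by simp [hM, x.den_nz]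
  have hMQ : (M : ℚ) ≠ 0 := by exact_mod_cast hM0
  have hbM : IsCoprime b M := by
    rw [Int.isCoprime_iff_gcd_eq_one]; exact x.reduced
  have hx_eq : x = (b : ℚ) / M := by rw [hb, hM]; push_cast; exact (Rat.num_div_den x).symm
  -- the modulus `d = gcd(M, N)`; `ℓ ≡ 1 (mod d)`
  have hd_eq : Int.gcd M N = Nat.gcd x.den N := by rw [hM, Int.gcd_natCast_natCast]
  have hℓ1 : (ℓ : ZMod (Int.gcd M N)) = 1 := by
    rw [hd_eq]
    have h := (ZMod.natCast_eq_natCast_iff' ℓ 1 (Nat.gcd x.den N)).mpr hx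
    rwa [Nat.cast_one] at h
  have hd_M : ((Int.gcd M N : ℕ) : ℤ) ∣ M := Int.gcd_dvd_left M N
  have hd_N : ((Int.gcd M N : ℕ) : ℤ) ∣ (N : ℤ) := Int.gcd_dvd_right M N
  have hM_d : ((M : ℤ) : ZMod (Int.gcd M N)) = 0 := (ZMod.intCast_zmod_eq_zero_iff_dvd _ _).mpr hd_M
  -- no pole at `x`
  obtain ⟨κ₁, hκ₁t, hκ₁d, hκ₁p⟩ := exists_gamma0_cuspSymbol_eq_apply_ne_zero f κ ((b : ℚ) / M)
  rw [hκ] at hκ₁d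
  -- the Hecke sum
  have hH : a * modularSymbol f x =
      ∑ j : Fin ℓ, modularSymbol f ((x + ((j : ℕ) : ℤ)) / ℓ) + modularSymbol f (ℓ * x) := by
    rw [← modularSymbol_smul, ← hT, modularSymbol_heckeT_eq_sum ℓ f hℓ, if_neg hℓN]
  -- the terms as fractions
  have hterm : ∀ j : Fin ℓ, (x + ((j : ℕ) : ℤ)) / ℓ = ((b + ((j : ℕ) : ℤ) * M : ℤ) : ℚ) / ((ℓ * M : ℤ) : ℚ) := by
    intro j; rw [hx_eq]; push_cast; field_simp
  set X := modularSymbol f x with hX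
  set t := cuspSymbol f κ with ht
  -- generic term `j` with `ℓ ∤ b + jM`: `≡ X + t`
  have hgen : ∀ j : Fin ℓ, ¬ (ℓ : ℤ) ∣ b + ((j : ℕ) : ℤ) * M →
      modularSymbol f ((x + ((j : ℕ) : ℤ)) / ℓ) - X - t ∈ periodLatticeGamma1 f := by
    intro j hj
    rw [hterm j, hX, hx_eq, ← hκ₁t]
    refine modularSymbol_sub_sub_cuspSymbol_mem_periodLatticeGamma1 f κ₁ hκ₁d hbM ?_ hM0 (mul_ne_zero hℓ0 hM0) hκ₁p
      ?_ ?_ hℓ1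
    · have h1 : IsCoprime (b + ((j : ℕ) : ℤ) * M) M := by
        simpa [mul_comm] using hbM.add_mul_right_left ((j : ℕ) : ℤ)
      exact IsCoprime.mul_right ((hℓP.coprime_iff_not_dvd.mpr hj).symm) h1
    · push_cast; ring
    · push_cast; rw [hM_d, mul_zero, add_zero]
  by_cases hℓM : (ℓ : ℤ) ∣ M
  · -- CASE `ℓ ∣ M`: every `j` is generic; the last cusp `ℓx = b/(M/ℓ)` is `≡ X − t`
    obtain ⟨M', hM'⟩ := hℓM
    have hM'0 : M' ≠ 0 := by rintro rfl; exact hM0 (by rw [hM', mul_zero])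
    have hℓb : ¬ (ℓ : ℤ) ∣ b := fun h ↦ hℓP.not_unit (hbM.isUnit_of_dvd' h ⟨M', hM'⟩)
    have hall : ∀ j : Fin ℓ, modularSymbol f ((x + ((j : ℕ) : ℤ)) / ℓ) - X - t ∈ periodLatticeGamma1 f := by
      intro j
      refine hgen j fun h ↦ hℓb ?_
      have : (ℓ : ℤ) ∣ ((j : ℕ) : ℤ) * M := Dvd.dvd.mul_left ⟨M', hM'⟩ _
      simpa using (dvd_sub h this)
    -- the last cusp
    have hbM' : IsCoprime b M' := by
      rw [hM'] at hbM; exact hbM.of_mul_right_right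
    have hlast_eq : (ℓ : ℚ) * x = (b : ℚ) / M' := by
      rw [hx_eq, hM']; push_cast
      have : (M' : ℚ) ≠ 0 := by exact_mod_cast hM'0
      field_simp
    obtain ⟨κ₂, hκ₂t, hκ₂d, hκ₂p⟩ := exists_gamma0_cuspSymbol_eq_apply_ne_zero f κ ((b : ℚ) / M')
    rw [hκ] at hκ₂d
    have hd'_dvd : Int.gcd M' N ∣ Int.gcd M N := by
      have h1 : ((Int.gcd M' N : ℕ) : ℤ) ∣ M := (Int.gcd_dvd_left M' N).trans ⟨ℓ, by rw [hM', mul_comm]⟩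
      have h : ((Int.gcd M' N : ℕ) : ℤ) ∣ ((Int.gcd M N : ℕ) : ℤ) := Int.dvd_coe_gcd h1 (Int.gcd_dvd_right M' N)
      exact_mod_cast h
    have hlast : X - modularSymbol f (ℓ * x) - t ∈ periodLatticeGamma1 f := by
      rw [hlast_eq, hX, hx_eq, ht, ← hκ₂t]
      refine modularSymbol_sub_sub_cuspSymbol_mem_periodLatticeGamma1 f κ₂ hκ₂d hbM' hbM hM'0 hM0 hκ₂p ?_ rfl ?_
      · rw [hM']; push_cast; ring
      · have h := natCast_zmod_eq_of_dvd hd'_dvd (x := ℓ) (y := 1) (by rw [Nat.cast_one]; exact hℓ1)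
        rwa [Nat.cast_one] at h
    have hkey : a * X - ((ℓ : ℂ) + 1) * X - ((ℓ : ℂ) - 1) * t =
        ∑ j : Fin ℓ, (modularSymbol f ((x + ((j : ℕ) : ℤ)) / ℓ) - X - t) - (X - modularSymbol f (ℓ * x) - t) := by
      rw [Finset.sum_sub_distrib, Finset.sum_sub_distrib, Finset.sum_const, Finset.sum_const, Finset.card_univ,
        Fintype.card_fin, nsmul_eq_mul, nsmul_eq_mul, hX, hH]
      ring
    rw [hkey]
    exact sub_mem (sum_mem fun j _ ↦ hall j) hlast
  · -- CASE `ℓ ∤ M`: one exceptional `j₀` (`≡ X`), the others generic; the last cusp `ℓb/M` is `≡ X`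
    obtain ⟨j₀, hj₀, huniq⟩ := existsUnique_fin_dvd_add_mul hℓ (b := b) hℓM
    obtain ⟨u, hu⟩ := hj₀
    have huM : IsCoprime u M := by
      have h1 : IsCoprime (b + ((j₀ : ℕ) : ℤ) * M) M := by
        simpa [mul_comm] using hbM.add_mul_right_left ((j₀ : ℕ) : ℤ)
      rw [hu] at h1
      exact h1.of_mul_left_right
    have hj₀_eq : (x + ((j₀ : ℕ) : ℤ)) / ℓ = (u : ℚ) / M := by
      rw [hterm j₀]
      have huQ : ((b + ((j₀ : ℕ) : ℤ) * M : ℤ) : ℚ) = ℓ * u := by exact_mod_cast hu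
      rw [huQ]; push_cast
      rw [mul_div_mul_left _ _ hℓQ]
    have hexc : modularSymbol f ((x + ((j₀ : ℕ) : ℤ)) / ℓ) - X ∈ periodLatticeGamma1 f := by
      rw [hj₀_eq, hX, hx_eq]
      refine modularSymbol_sub_mem_periodLatticeGamma1_of_congr f hbM huM hM0 hM0 rfl ?_
      -- `ℓu = b + j₀M ≡ b (mod d)` and `ℓ ≡ 1`
      have h := congrArg (fun z : ℤ ↦ (z : ZMod (Int.gcd M N))) hu
      simp only [Int.cast_add, Int.cast_mul, hM_d, mul_zero, add_zero, Int.cast_natCast, hℓ1, one_mul] at h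
      exact h.symm
    have hothers : ∀ j : Fin ℓ, j ≠ j₀ →
        modularSymbol f ((x + ((j : ℕ) : ℤ)) / ℓ) - X - t ∈ periodLatticeGamma1 f :=
      fun j hne ↦ hgen j fun h ↦ hne (huniq j h)
    have hlast : modularSymbol f (ℓ * x) - X ∈ periodLatticeGamma1 f := by
      have e : (ℓ : ℚ) * x = ((ℓ * b : ℤ) : ℚ) / M := by rw [hx_eq]; push_cast; ring
      rw [e, hX, hx_eq]
      refine modularSymbol_sub_mem_periodLatticeGamma1_of_congr f hbM ?_ hM0 hM0 rfl ?_
      · exact IsCoprime.mul_left (hℓP.coprime_iff_not_dvd.mpr hℓM) hbM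
      · push_cast; rw [hℓ1, one_mul]
    have hsum : ∑ j : Fin ℓ, (modularSymbol f ((x + ((j : ℕ) : ℤ)) / ℓ) - X - t) =
        (modularSymbol f ((x + ((j₀ : ℕ) : ℤ)) / ℓ) - X - t) +
          ∑ j ∈ Finset.univ.erase j₀, (modularSymbol f ((x + ((j : ℕ) : ℤ)) / ℓ) - X - t) :=
      (Finset.add_sum_erase _ _ (Finset.mem_univ j₀)).symm
    have hkey : a * X - ((ℓ : ℂ) + 1) * X - ((ℓ : ℂ) - 1) * t =
        (modularSymbol f ((x + ((j₀ : ℕ) : ℤ)) / ℓ) - X) +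
          ∑ j ∈ Finset.univ.erase j₀, (modularSymbol f ((x + ((j : ℕ) : ℤ)) / ℓ) - X - t) +
          (modularSymbol f (ℓ * x) - X) := by
      have h1 : a * X - ((ℓ : ℂ) + 1) * X - ((ℓ : ℂ) - 1) * t =
          ∑ j : Fin ℓ, (modularSymbol f ((x + ((j : ℕ) : ℤ)) / ℓ) - X - t) + t + (modularSymbol f (ℓ * x) - X) := by
        rw [Finset.sum_sub_distrib, Finset.sum_sub_distrib, Finset.sum_const, Finset.sum_const, Finset.card_univ,
          Fintype.card_fin, nsmul_eq_mul, nsmul_eq_mul, hX, hH]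
        ring
      rw [h1, hsum]
      ring
    rw [hkey]
    exact add_mem (add_mem hexc (sum_mem fun j hjm ↦ hothers j (Finset.ne_of_mem_erase hjm))) hlast

/-! ### §6 THEOREM 92.A: `(1 + ℓ − a)·({∞, r}_f − {∞, 0}_f) ∈ Λ₁(f)` for `ℓ ≡ 1 (mod gcd(den r, N))` -/

/-- **The cuspidal class `(r) − (0)` is killed by `1 + ℓ − a_ℓ` in `ℂ/Λ₁(f)` at every prime `ℓ ∤ N` with
`ℓ ≡ 1 (mod gcd(den r, N))`** (`T_ℓ f = a f` on `Γ₀(N)`; E-es-363e of cell bsd-f2-manin).  Apply §5 at `r` and at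
`0` (where `gcd(1, N) = 1`) with the same `κ` and subtract: the `{∞, κ∞}_f` terms cancel.
[cite: Stevens1982, Thm. 1.3.1 and Thm. 1.3.2(b) (Galois structure of the cuspidal group / Eichler–Shimura on cuspidal divisors; the period-lattice form at modulus gcd(den r, N) is MEMO-es §92.2 of cell bsd-f2-manin, proved here)]
[cite: DiamondShurman2005, Prop. 3.8.3, Prop. 5.2.1] -/
theorem one_add_sub_mul_modularSymbol_sub_mem_periodLatticeGamma1 {ℓ : ℕ} [NeZero ℓ] (hℓ : ℓ.Prime)
    (hℓN : ¬ ℓ ∣ N) {a : ℂ} (hT : heckeT (Gamma0 N) 2 ℓ f = a • f) (r : ℚ) (hr : ℓ ≡ 1 [MOD Nat.gcd r.den N]) :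
    (1 + (ℓ : ℂ) - a) * (modularSymbol f r - modularSymbol f 0) ∈ periodLatticeGamma1 f := by
  have hℓu : IsUnit (ℓ : ZMod N) := by
    rw [← ZMod.coe_unitOfCoprime ℓ ((Nat.Prime.coprime_iff_not_dvd hℓ).mpr hℓN)]
    exact Units.isUnit _
  obtain ⟨κ, hκ⟩ := exists_gamma0_apply_one_one_eq_of_isUnit hℓu
  have h1 := modularSymbol_hecke_sub_sub_mem_periodLatticeGamma1 f hℓ hℓN hT κ hκ r hr
  have h0 := modularSymbol_hecke_sub_sub_mem_periodLatticeGamma1 f hℓ hℓN hT κ hκ 0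
    (by rw [Rat.den_zero, Nat.gcd_one_left]; exact Nat.modEq_one)
  have h := sub_mem h1 h0
  convert neg_mem h using 1
  ring

/-- **E-es-363e `CuspClassHeckeAnnihilationEigen`** — verbatim the `Prop` typed by es g63 (`Sketch-es-g63.lean`), now a
theorem: for `f ∈ S₂(Γ₀(N))`, `T_ℓ f = a f`, `ℓ ∤ N` prime, `r ∈ ℚ`, `ℓ ≡ 1 (mod gcd(den r, N))`:
`(1 + ℓ − a)·({∞, r}_f − {∞, 0}_f) ∈ Λ₁(f)`.  (With `IsNewform0.heckeT_eq_coeff_smul` it gives the newform form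
E-es-363, and at `gcd = 1` it is the tree's Manin+Ribet layer.)
[cite: Stevens1982, Thm. 1.3.2(b); period-lattice form = MEMO-es §92.2 THM 92.A, proved here] -/
theorem cuspClassHeckeAnnihilationEigen :
    ∀ (N : ℕ) [NeZero N] (f : CuspForm (Gamma0 N) 2) (ℓ : ℕ) [NeZero ℓ] (a : ℂ), ℓ.Prime → ¬ ℓ ∣ N →
      heckeT (Gamma0 N) 2 ℓ f = a • f → ∀ (r : ℚ), ℓ ≡ 1 [MOD Nat.gcd r.den N] →
        (1 + (ℓ : ℂ) - a) * (modularSymbol f r - modularSymbol f 0) ∈ periodLatticeGamma1 f :=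
  fun _ _ f _ _ _ hℓ hℓN hT r hr ↦ one_add_sub_mul_modularSymbol_sub_mem_periodLatticeGamma1 f hℓ hℓN hT r hr

/-- **Newform form (E-es-363 `CuspClassHeckeAnnihilation`)**: for a normalised newform `f ∈ S₂(Γ₀(N))`, a prime
`ℓ ∤ N` and `r ∈ ℚ` with `ℓ ≡ 1 (mod gcd(den r, N))`: `(1 + ℓ − a_ℓ(f))·({∞, r}_f − {∞, 0}_f) ∈ Λ₁(f)`.
[cite: Stevens1982, Thm. 1.3.1–1.3.2; period-lattice form proved here] [cite: DiamondShurman2005, Prop. 5.8.5] -/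
theorem one_add_sub_cuspCoeff_mul_modularSymbol_sub_mem_periodLatticeGamma1 (hf : IsNewform0 f) {ℓ : ℕ}
    (hℓ : ℓ.Prime) (hℓN : ¬ ℓ ∣ N) (r : ℚ) (hr : ℓ ≡ 1 [MOD Nat.gcd r.den N]) :
    (1 + (ℓ : ℂ) - cuspCoeff f ℓ) * (modularSymbol f r - modularSymbol f 0) ∈ periodLatticeGamma1 f := by
  haveI : NeZero ℓ := ⟨hℓ.ne_zero⟩
  exact one_add_sub_mul_modularSymbol_sub_mem_periodLatticeGamma1 f hℓ hℓN (hf.heckeT_eq_coeff_smul hℓ) r hr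

end Literature.NumberTheory.EllipticCurves.ModularForms

end
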